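import Summits.QuantumFields.YangMills.Theorems.BalabanUVNodesN19DiscreteJacksonPricing
import Summits.QuantumFields.YangMills.Theorems.BalabanUVNodesN19LawPrice

/-!
# YM-DAG node N19 (= NE7 proper) — THE PRICE OF UNIFORM MOMENT CLOSENESS IS `Θ(1∕log r⁻¹)`, TWO-SIDED (discrete Jackson ∕ binomial witness)

Cell `pub-ymgap`, HUMAN RULING D-0062 (Track A), R141 (C) wider-strategy seat `pub-ymgap-dag-n19-e` (strategy s3 = ALTERNATIVE CURRENCY), generation
g20, module 5 (lineage module 63).  Route `Summits/QuantumFields/YangMills/Theses/BalabanUVNodes.lean` rev 25, cluster item K3⁷ «SpineGivenEndpointR13SepCoPH»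
(stmt-QuantumFields-20544, dag-lead WORDS-143); filed `--supports` that item `--as helper` (it proves no registered stub).  COUNT-NEUTRAL: [folklore] real
analysis ∕ probability over Mathlib + the lineage BY NAME: module 61 `…N19DiscreteJacksonPricing` (`abs_integral_sub_integral_le_of_mixedMoments_jackson`),
p543481 `…N19LawPrice` (`exists_binomial_witness`, `cosWave_grid`, `lipschitzWith_one_cosWave`, `cosWave_nonneg`, `cosWave_le`) and p510514
`…N19NoLinearPrice` (`exists_lawPair_of_weights`); no scheme object, no Theses import; NOT a discharge claim.

THE QUESTION.  At the scheme under UNIFORM `Target` every moment of a string observable converges at ONE rate `R_K` (p566839 ∕ p570436: the `k`-th moment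
is the expectation of the `k`-fold concatenated string, and p482030's rate does not see the string) — UNIFORMLY IN THE DEGREE, unlike the window-cgf
currency of ONE string (moments of order `j` only within `j!·(2eL∕(jl₀))^j·ε`, p546312), whose law-level price is `log(e+L)∕(1+L)` two-sided (p553677 ∕
p555512).  What is the law-level price of UNIFORM moment closeness `sup_j |∫x^j dν − ∫x^j dμ| ≤ r`?

THE ANSWER: `Θ(1∕log r⁻¹)` — no `log log`, two-sided.  §1 UPPER (module 61's discrete Jackson quasi-interpolant at `|ι| = 1`, transported through
`x ↦ (x)_{Unit}`): for laws on `[−1,1]` with moments of order `≤ 2m` within `r`, ★ `|∫g dν − ∫g dμ| ≤ 2πK∕m + G·m·9^m·r` for every `m ≥ 1`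
(`abs_integral_sub_integral_le_of_moments_jackson`), and with ALL moments within `0 < r ≤ 1`, choosing `m = ⌊L∕5⌋ + 1` (`L = log r⁻¹`; `log 9 ≤ 5∕2`,
`e^{L∕2} ≥ (1 + L∕4)²`): ★★ `law_price_le_of_uniformMoments`: `|∫g dν − ∫g dμ| ≤ 48(K+G)∕(1+L)`.  §2 LOWER — THE BINOMIAL WITNESS ON `[0,½]`: p543481's
signed binomial weights `w_k = 2^{1−n}(−1)^{n−k}C(n,k)` placed at `k∕(2n)` (p510514 `exists_lawPair_of_weights` at `M = 2n` with the weights extended by `0`)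
have moments `j < n` EQUAL and moments `j ≥ n` trivially within `Σ|w_k|·2^{−j} ≤ 2·2^{−n}`, while the `1`-Lipschitz, `[0, 1∕(πn)]`-valued test function
`(1 − cos(2πnx))∕(2πn)` (p543481's `g_{2n}`) is paid EXACTLY `1∕(πn)`: ★★ `exists_uniformMoments_close_laws_far`.  §3 ★★ `uniformMoment_price_two_sided`:
for every `0 < r₀ ≤ 1` a pair with ALL moments within some `r ≤ r₀` and a `1`-Lipschitz `[0,1]`-valued `g` paid `≥ (1∕6)∕(1 + log r⁻¹)`, against §1's
`48(K+G)∕(1 + log r⁻¹)` for every pair and every `g`.  AT THE SCHEME (module 62 §1 at `|ι| = 1`): under uniform `Target` each marginal continuum law is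
approached at `≍ 1∕log R_K⁻¹ ≍ 1∕K` for geometric remainders — the `log K` of p556871's `log K∕K` was the price of using the window of ONE string only.

HONEST FRAMING (binding).  Elementary and [folklore] (Jackson 1911 ∕ Favard duality; the signed binomial measure); NO consumer in the DAG today (optimality
statement about the seat's own currency); nothing of Bałaban's instantiated; NE7 NOT PRINTED, NOT proved; N19 NOT discharged; count-neutral.  One finite `T⁴`
programme at fixed `ε`; nothing continuum ∕ `ℝ⁴` ∕ OS ∕ mass-gap ∕ Clay.  0 `def` ∕ 0 `sorry`.
-/

noncomputable section

open Real Finset MeasureTheory ProbabilityTheory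

namespace Summit.QuantumFields.YangMills.Theorems.BalabanUVNodesN19UniformMomentPriceTwoSided

open Summit.QuantumFields.YangMills.Theorems.BalabanUVNodesN19DiscreteJacksonPricing (abs_integral_sub_integral_le_of_mixedMoments_jackson)
open Summit.QuantumFields.YangMills.Theorems.BalabanUVNodesN19LawPrice
  (exists_binomial_witness cosWave_grid lipschitzWith_one_cosWave cosWave_nonneg cosWave_le)
open Summit.QuantumFields.YangMills.Theorems.BalabanUVNodesN19NoLinearPrice (exists_lawPair_of_weights)

variable {μ ν : Measure ℝ} [IsProbabilityMeasure μ] [IsProbabilityMeasure ν]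

/-! ## §1 UPPER: laws on `[−1,1]` with moments within `r` are `2πK∕m + G·m·9^m·r`-close on Lipschitz functions; `48(K+G)∕(1 + log r⁻¹)` [folklore] -/

/-- ★ **MOMENTS OF ORDER `≤ 2m` WITHIN `r` ⇒ `|∫g dν − ∫g dμ| ≤ 2πK∕m + G·m·9^m·r`** — module 61's `|ι|`-dimensional theorem at `|ι| = 1`, transported through
`x ↦ (x)_{u : Unit}` (laws on `[−1,1]`; `g` continuous, `K`-Lipschitz and `G`-bounded on `[−1,1]`; `m ≥ 1`, `0 ≤ r`). [folklore] -/
theorem abs_integral_sub_integral_le_of_moments_jackson (hμ : μ (Set.Icc (-1 : ℝ) 1)ᶜ = 0) (hν : ν (Set.Icc (-1 : ℝ) 1)ᶜ = 0)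
    {m : ℕ} (hm : 0 < m) {r : ℝ} (hr : 0 ≤ r) (hmom : ∀ j : ℕ, j ≤ 2 * m → |∫ x, x ^ j ∂ν - ∫ x, x ^ j ∂μ| ≤ r)
    {g : ℝ → ℝ} (hg : Continuous g) {K G : ℝ} (hK0 : 0 ≤ K)
    (hK : ∀ x y : ℝ, x ∈ Set.Icc (-1 : ℝ) 1 → y ∈ Set.Icc (-1 : ℝ) 1 → |g x - g y| ≤ K * |x - y|)
    (hG : ∀ x : ℝ, x ∈ Set.Icc (-1 : ℝ) 1 → |g x| ≤ G) :
    |∫ x, g x ∂ν - ∫ x, g x ∂μ| ≤ 2 * K * (π / m) + G * (m * 9 ^ m) * r := by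
  classical
  -- transport to laws on `Unit → ℝ`
  have hvec : Measurable fun x : ℝ => fun _ : Unit => x := measurable_pi_lambda _ fun _ => measurable_id
  have hcube : ∀ (κ : Measure ℝ), κ (Set.Icc (-1 : ℝ) 1)ᶜ = 0 →
      (κ.map fun x : ℝ => fun _ : Unit => x) (Set.pi Set.univ (fun _ : Unit => Set.Icc (-1 : ℝ) 1))ᶜ = 0 := by
    intro κ hκ
    rw [Measure.map_apply hvec (MeasurableSet.univ_pi fun _ => measurableSet_Icc).compl]
    have he : (fun x : ℝ => fun _ : Unit => x) ⁻¹' (Set.pi Set.univ (fun _ : Unit => Set.Icc (-1 : ℝ) 1))ᶜ = (Set.Icc (-1 : ℝ) 1)ᶜ := by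
      ext x
      simp only [Set.mem_preimage, Set.mem_compl_iff, Set.mem_univ_pi, not_forall]
      exact ⟨fun ⟨_, h⟩ => h, fun h => ⟨(), h⟩⟩
    rw [he, hκ]
  have hint : ∀ (κ : Measure ℝ) {h : (Unit → ℝ) → ℝ}, Continuous h →
      ∫ u, h u ∂(κ.map fun x : ℝ => fun _ : Unit => x) = ∫ x, h (fun _ : Unit => x) ∂κ :=
    fun κ _ hh => integral_map hvec.aemeasurable hh.aestronglyMeasurable
  haveI : IsProbabilityMeasure (ν.map fun x : ℝ => fun _ : Unit => x) := Measure.isProbabilityMeasure_map hvec.aemeasurable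
  haveI : IsProbabilityMeasure (μ.map fun x : ℝ => fun _ : Unit => x) := Measure.isProbabilityMeasure_map hvec.aemeasurable
  -- mixed moments of the transported laws are the moments
  have hmom' : ∀ j : Unit → Fin (2 * m + 1),
      |∫ u, ∏ i, u i ^ (j i : ℕ) ∂(ν.map fun x : ℝ => fun _ : Unit => x) -
        ∫ u, ∏ i, u i ^ (j i : ℕ) ∂(μ.map fun x : ℝ => fun _ : Unit => x)| ≤ r := by
    intro j
    have hc : Continuous fun u : Unit → ℝ => ∏ i, u i ^ (j i : ℕ) := continuous_finsetProd _ fun i _ => (continuous_apply i).pow _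
    rw [hint ν hc, hint μ hc]
    simp only [Finset.univ_unique, Finset.prod_singleton]
    exact hmom _ (Nat.lt_succ_iff.1 (j default).2)
  -- the transported test function
  have hf : Continuous fun u : Unit → ℝ => g (u default) := hg.comp (continuous_apply _)
  have hK' : ∀ u v : Unit → ℝ, (∀ i, u i ∈ Set.Icc (-1 : ℝ) 1) → (∀ i, v i ∈ Set.Icc (-1 : ℝ) 1) →
      |g (u default) - g (v default)| ≤ K * ∑ i, |u i - v i| := fun u v hu hv => by
    rw [Finset.univ_unique, Finset.sum_singleton]
    exact hK _ _ (hu _) (hv _)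
  have hG' : ∀ u : Unit → ℝ, (∀ i, u i ∈ Set.Icc (-1 : ℝ) 1) → |g (u default)| ≤ G := fun u hu => hG _ (hu _)
  have h := abs_integral_sub_integral_le_of_mixedMoments_jackson (hcube ν hν) (hcube μ hμ) hm hr hmom' hf hK0 hK' hG'
  rw [hint ν hf, hint μ hf, Fintype.card_unique, Nat.cast_one, mul_one, pow_one] at h
  exact h

/-- `log 9 ≤ 5∕2` (`log 3 ≤ 3∕e`, `e > 2.7`). [bookkeeping] -/
theorem log_nine_le_five_halves : Real.log 9 ≤ 5 / 2 := by
  have he : (2.7 : ℝ) < Real.exp 1 := lt_trans (by norm_num) Real.exp_one_gt_d9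
  have h3 : Real.log 3 ≤ 3 / Real.exp 1 := by
    have h := Real.log_le_sub_one_of_pos (by positivity : (0 : ℝ) < 3 / Real.exp 1)
    rw [Real.log_div (by norm_num) (Real.exp_pos 1).ne', Real.log_exp] at h
    linarith
  have h3' : Real.log 3 ≤ 5 / 4 := by
    refine h3.trans ?_
    rw [div_le_iff₀ (Real.exp_pos 1)]
    linarith
  rw [show (9 : ℝ) = 3 * 3 by norm_num, Real.log_mul (by norm_num) (by norm_num)]
  linarith

/-- `(1 + L∕4)² ≤ e^{L∕2}` for `0 ≤ L` (`1 + x ≤ eˣ` squared). [bookkeeping] -/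
theorem one_add_quarter_sq_le_exp_half {L : ℝ} (hL : 0 ≤ L) : (1 + L / 4) ^ 2 ≤ Real.exp (L / 2) := by
  have h := Real.add_one_le_exp (L / 4)
  have h0 : 0 ≤ L / 4 + 1 := by positivity
  calc (1 + L / 4) ^ 2 = (L / 4 + 1) ^ 2 := by ring
    _ ≤ Real.exp (L / 4) ^ 2 := pow_le_pow_left₀ h0 h 2
    _ = Real.exp (L / 2) := by rw [← Real.exp_nat_mul]; ring_nf

/-- ★★ **THE LAW-LEVEL PRICE OF UNIFORM MOMENT CLOSENESS FROM ABOVE: `48(K+G)∕(1 + log r⁻¹)`.**  Two probability laws `μ, ν` on `[−1,1]` with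
`|∫x^j dν − ∫x^j dμ| ≤ r` for EVERY `j` (`0 < r ≤ 1`); `g` continuous, `K`-Lipschitz and `G`-bounded on `[−1,1]`.  Then
`|∫g dν − ∫g dμ| ≤ 48(K + G)∕(1 + log r⁻¹)` (§1 at `m = ⌊log r⁻¹∕5⌋ + 1`: `2πK∕m ≤ 12πK∕(1+L)`, `m·9^m·r ≤ 9(1 + L∕5)e^{−L∕2} ≤ 36∕(1+L)`). [folklore] -/
theorem law_price_le_of_uniformMoments (hμ : μ (Set.Icc (-1 : ℝ) 1)ᶜ = 0) (hν : ν (Set.Icc (-1 : ℝ) 1)ᶜ = 0)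
    {r : ℝ} (hr0 : 0 < r) (hr1 : r ≤ 1) (hmom : ∀ j : ℕ, |∫ x, x ^ j ∂ν - ∫ x, x ^ j ∂μ| ≤ r)
    {g : ℝ → ℝ} (hg : Continuous g) {K G : ℝ} (hK0 : 0 ≤ K)
    (hK : ∀ x y : ℝ, x ∈ Set.Icc (-1 : ℝ) 1 → y ∈ Set.Icc (-1 : ℝ) 1 → |g x - g y| ≤ K * |x - y|)
    (hG : ∀ x : ℝ, x ∈ Set.Icc (-1 : ℝ) 1 → |g x| ≤ G) :
    |∫ x, g x ∂ν - ∫ x, g x ∂μ| ≤ 48 * (K + G) / (1 + Real.log r⁻¹) := by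
  have hG0 : 0 ≤ G := (abs_nonneg _).trans (hG 0 (by norm_num))
  set L : ℝ := Real.log r⁻¹ with hLdef
  have hL0 : 0 ≤ L := Real.log_nonneg ((one_le_inv₀ hr0).2 hr1)
  have hrL : r = Real.exp (-L) := by rw [Real.exp_neg, hLdef, Real.exp_log (inv_pos.2 hr0), inv_inv]
  -- the Jackson parameter
  set m : ℕ := ⌊L / 5⌋₊ + 1 with hmdef
  have hm : 0 < m := Nat.succ_pos _
  have hmr : (m : ℝ) = ⌊L / 5⌋₊ + 1 := by rw [hmdef]; push_cast; ring
  have hfloor : (⌊L / 5⌋₊ : ℝ) ≤ L / 5 := Nat.floor_le (by positivity)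
  have hmup : (m : ℝ) ≤ L / 5 + 1 := by rw [hmr]; linarith
  have hmlow : (1 + L) / 6 ≤ m := by
    rw [hmr]
    have := Nat.lt_floor_add_one (L / 5)
    linarith
  have hmpos : (0 : ℝ) < m := Nat.cast_pos.2 hm
  -- §1 at `m`
  have h := abs_integral_sub_integral_le_of_moments_jackson hμ hν hm hr0.le (fun j _ => hmom j) hg hK0 hK hG
  -- `2πK∕m ≤ 12πK∕(1+L) ≤ 48K∕(1+L)`
  have hA : 2 * K * (π / m) ≤ 48 * K / (1 + L) := by
    rw [mul_div_assoc', div_le_div_iff₀ hmpos (by positivity)]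
    have hπ := Real.pi_le_four
    nlinarith [mul_le_mul_of_nonneg_left hπ (by positivity : (0 : ℝ) ≤ 2 * K * (1 + L)),
      mul_le_mul_of_nonneg_left hmlow (by positivity : (0 : ℝ) ≤ 48 * K)]
  -- `m·9^m·r ≤ 36∕(1+L)`
  have h9m : (9 : ℝ) ^ m ≤ 9 * Real.exp (L / 2) := by
    rw [hmdef, pow_succ, mul_comm]
    refine mul_le_mul_of_nonneg_left ?_ (by norm_num)
    rw [← Real.exp_log (by norm_num : (0 : ℝ) < 9), ← Real.exp_nat_mul]
    refine Real.exp_le_exp.2 ?_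
    calc (⌊L / 5⌋₊ : ℝ) * Real.log 9 ≤ L / 5 * (5 / 2) :=
          mul_le_mul hfloor log_nine_le_five_halves (Real.log_nonneg (by norm_num)) (by positivity)
      _ = L / 2 := by ring
  have hB : (m : ℝ) * 9 ^ m * r ≤ 36 / (1 + L) := by
    have hE := one_add_quarter_sq_le_exp_half hL0
    have hE0 : 0 < Real.exp (L / 2) := Real.exp_pos _
    have hexp : Real.exp (L / 2) * Real.exp (L / 2) * r = 1 := by
      rw [hrL, ← Real.exp_add, ← Real.exp_add, show L / 2 + L / 2 + -L = 0 by ring, Real.exp_zero]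
    -- `m·9^m·r ≤ (L∕5 + 1)·9·e^{L∕2}·e^{−L} = 9(1 + L∕5)∕e^{L∕2}`
    have h1 : (m : ℝ) * 9 ^ m * r ≤ (L / 5 + 1) * (9 * Real.exp (L / 2)) * r :=
      mul_le_mul_of_nonneg_right (mul_le_mul hmup h9m (by positivity) (by positivity)) hr0.le
    have h2 : (L / 5 + 1) * (9 * Real.exp (L / 2)) * r * Real.exp (L / 2) = 9 * (L / 5 + 1) := by
      calc (L / 5 + 1) * (9 * Real.exp (L / 2)) * r * Real.exp (L / 2)
          = 9 * (L / 5 + 1) * (Real.exp (L / 2) * Real.exp (L / 2) * r) := by ring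
        _ = 9 * (L / 5 + 1) := by rw [hexp, mul_one]
    -- divide by `e^{L∕2} ≥ (1 + L∕4)²`
    have h3 : (L / 5 + 1) * (9 * Real.exp (L / 2)) * r ≤ 9 * (L / 5 + 1) / (1 + L / 4) ^ 2 := by
      rw [le_div_iff₀ (by positivity)]
      calc (L / 5 + 1) * (9 * Real.exp (L / 2)) * r * (1 + L / 4) ^ 2
          ≤ (L / 5 + 1) * (9 * Real.exp (L / 2)) * r * Real.exp (L / 2) :=
            mul_le_mul_of_nonneg_left hE (by positivity)
        _ = 9 * (L / 5 + 1) := h2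
    have h4 : 9 * (L / 5 + 1) / (1 + L / 4) ^ 2 ≤ 36 / (1 + L) := by
      rw [div_le_div_iff₀ (by positivity) (by positivity)]
      nlinarith [hL0, sq_nonneg L]
    linarith
  calc |∫ x, g x ∂ν - ∫ x, g x ∂μ| ≤ 2 * K * (π / m) + G * (m * 9 ^ m) * r := h
    _ ≤ 48 * K / (1 + L) + G * (36 / (1 + L)) := by
        refine add_le_add hA ?_
        rw [mul_assoc]
        exact mul_le_mul_of_nonneg_left hB hG0
    _ ≤ 48 * (K + G) / (1 + L) := by
        rw [mul_div_assoc', ← add_div, div_le_div_iff_of_pos_right (by positivity)]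
        nlinarith

/-! ## §2 LOWER: the binomial witness on `[0, ½]` — all moments `2·2^{−n}`-close, a `1`-Lipschitz function `1∕(πn)` apart [folklore] -/

/-- Restricting a sum over `{0,…,2n}` to `{0,…,n}` through an indicator. [bookkeeping] -/
theorem sum_range_ite_le (n : ℕ) (φ : ℕ → ℝ) :
    ∑ k ∈ range (2 * n + 1), (if k ≤ n then φ k else 0) = ∑ k ∈ range (n + 1), φ k := by
  rw [← Finset.sum_filter]
  congr 1
  ext k
  simp only [Finset.mem_filter, Finset.mem_range]
  omega

/-- **★★ ALL MOMENTS `2·2^{−n}`-CLOSE, LAWS `1∕(πn)` APART IN THE BOUNDED-LIPSCHITZ METRIC.**  For every `n ≥ 1`: two probability laws `μ, ν` on `[0, 1]`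
(p543481's signed binomial weights placed at the points `k∕(2n)`, `k ≤ n`, through p510514's `exists_lawPair_of_weights`) such that
`|∫x^j dν − ∫x^j dμ| ≤ 2·(1∕2)^n` for EVERY `j` (`= 0` for `j < n`), and the `1`-Lipschitz, `[0, 1∕(πn)]`-valued test function `(1 − cos(2πnx))∕(2πn)` is paid
`|∫ … dν − ∫ … dμ| = 1∕(πn)`. [folklore] -/
theorem exists_uniformMoments_close_laws_far {n : ℕ} (hn : 0 < n) :
    ∃ μ ν : Measure ℝ, IsProbabilityMeasure μ ∧ IsProbabilityMeasure ν ∧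
      μ (Set.Icc 0 1)ᶜ = 0 ∧ ν (Set.Icc 0 1)ᶜ = 0 ∧
      (∀ j : ℕ, |∫ x, x ^ j ∂ν - ∫ x, x ^ j ∂μ| ≤ 2 * (1 / 2 : ℝ) ^ n) ∧
      (∀ j : ℕ, j < n → ∫ x, x ^ j ∂ν = ∫ x, x ^ j ∂μ) ∧
      |∫ x, (1 - cos (π * (2 * n : ℕ) * x)) / (π * (2 * n : ℕ)) ∂ν - ∫ x, (1 - cos (π * (2 * n : ℕ) * x)) / (π * (2 * n : ℕ)) ∂μ| =
        1 / (π * n) := by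
  obtain ⟨w, ε, -, h0, h2, -, -, -, -, hmom, htest⟩ := exists_binomial_witness one_pos hn
  have hnr : (0 : ℝ) < n := Nat.cast_pos.2 hn
  -- extend the weights by `0` to the grid `{k∕(2n) : k ≤ 2n}`
  set w' : ℕ → ℝ := fun k => if k ≤ n then w k else 0 with hw'
  have h0' : ∑ k ∈ range (2 * n + 1), w' k = 0 := by rw [hw', sum_range_ite_le, h0]
  have habs : ∀ k, |w' k| = if k ≤ n then |w k| else 0 := fun k => by
    simp only [hw']; split_ifs <;> simp
  have h2' : ∑ k ∈ range (2 * n + 1), |w' k| = 2 := by simp_rw [habs]; rw [sum_range_ite_le, h2]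
  obtain ⟨μ, ν, iμ, iν, hμ, hν, hg⟩ := exists_lawPair_of_weights (M := 2 * n) w' h0' h2'
  -- every integral difference is a sum over the first `n + 1` grid points
  have hsum : ∀ g : ℝ → ℝ, ∫ x, g x ∂ν - ∫ x, g x ∂μ = ∑ k ∈ range (n + 1), w k * g ((k : ℝ) / (2 * n : ℕ)) := by
    intro g
    rw [hg g, ← sum_range_ite_le n]
    refine Finset.sum_congr rfl fun k _ => ?_
    simp only [hw']
    split_ifs <;> simp
  have hnode : ∀ k : ℕ, ((k : ℝ) / (2 * n : ℕ)) = (1 / 2) * ((k : ℝ) / n) := fun k => by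
    push_cast; field_simp
  refine ⟨μ, ν, iμ, iν, hμ, hν, fun j => ?_, fun j hj => ?_, ?_⟩
  · -- all moments `2·2^{−n}`-close
    rw [hsum fun x => x ^ j]
    rcases lt_or_ge j n with hj | hj
    · have e : ∑ k ∈ range (n + 1), w k * ((k : ℝ) / (2 * n : ℕ)) ^ j = (1 / 2 : ℝ) ^ j * ∑ k ∈ range (n + 1), w k * ((k : ℝ) / n) ^ j := by
        rw [Finset.mul_sum]
        exact Finset.sum_congr rfl fun k _ => by rw [hnode, mul_pow]; ring
      rw [e, hmom j hj, mul_zero, abs_zero]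
      positivity
    · calc |∑ k ∈ range (n + 1), w k * ((k : ℝ) / (2 * n : ℕ)) ^ j|
          ≤ ∑ k ∈ range (n + 1), |w k * ((k : ℝ) / (2 * n : ℕ)) ^ j| := abs_sum_le_sum_abs _ _
        _ ≤ ∑ k ∈ range (n + 1), |w k| * (1 / 2 : ℝ) ^ n := Finset.sum_le_sum fun k hk => by
            rw [abs_mul, abs_pow, hnode, abs_mul, mul_pow, abs_of_pos (by norm_num : (0 : ℝ) < 1 / 2)]
            refine mul_le_mul_of_nonneg_left ?_ (abs_nonneg _)
            have hkn : |(k : ℝ) / n| ≤ 1 := by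
              rw [abs_of_nonneg (by positivity), div_le_one hnr]
              exact_mod_cast Nat.lt_succ_iff.1 (Finset.mem_range.1 hk)
            calc (1 / 2 : ℝ) ^ j * |(k : ℝ) / n| ^ j ≤ (1 / 2 : ℝ) ^ j * 1 :=
                  mul_le_mul_of_nonneg_left (pow_le_one₀ (abs_nonneg _) hkn) (by positivity)
              _ ≤ (1 / 2 : ℝ) ^ n := by rw [mul_one]; exact pow_le_pow_of_le_one (by norm_num) (by norm_num) hj
        _ = 2 * (1 / 2 : ℝ) ^ n := by rw [← Finset.sum_mul, h2]
  · -- moments `< n` equal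
    have h := hsum fun x => x ^ j
    have e : ∑ k ∈ range (n + 1), w k * ((k : ℝ) / (2 * n : ℕ)) ^ j = (1 / 2 : ℝ) ^ j * ∑ k ∈ range (n + 1), w k * ((k : ℝ) / n) ^ j := by
      rw [Finset.mul_sum]
      exact Finset.sum_congr rfl fun k _ => by rw [hnode, mul_pow]; ring
    rw [e, hmom j hj, mul_zero] at h
    linarith
  · -- the test function is paid `1∕(πn)`
    have h2n : 0 < 2 * n := by omega
    rw [hsum fun x => (1 - cos (π * (2 * n : ℕ) * x)) / (π * (2 * n : ℕ)),
      Finset.sum_congr rfl fun k _ => by rw [cosWave_grid h2n k]]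
    have e : ∀ k : ℕ, w k * ((1 - (-1 : ℝ) ^ k) / (π * (2 * n : ℕ))) = (1 / 2 : ℝ) * (w k * ((1 - (-1 : ℝ) ^ k) / (π * n))) := fun k => by
      push_cast
      field_simp
    simp_rw [e]
    rw [← Finset.mul_sum, htest, abs_mul, abs_mul, abs_neg, abs_pow, abs_neg, abs_one, one_pow, one_mul,
      abs_of_pos (by norm_num : (0 : ℝ) < 1 / 2), abs_of_pos (by positivity : (0 : ℝ) < 2 / (π * n))]
    field_simp

/-! ## §3 ★★ TWO-SIDED: the law-level price of uniform moment closeness is `Θ(1∕(1 + log r⁻¹))` -/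

/-- **★★ THE PRICE OF UNIFORM MOMENT CLOSENESS IS `Θ(1∕log r⁻¹)`, TWO-SIDED** [folklore].
(i) UPPER: for all probability laws `μ, ν` on `[−1,1]` with `sup_j |∫x^j dν − ∫x^j dμ| ≤ r`, `0 < r ≤ 1`, and every continuous `g`, `K`-Lipschitz and
`G`-bounded on `[−1,1]`: `|∫g dν − ∫g dμ| ≤ 48(K+G)∕(1 + log r⁻¹)`;
(ii) LOWER: for every `0 < r₀ ≤ 1` there are probability laws `μ, ν` on `[0,1]` and `0 < r ≤ r₀` with `sup_j |∫x^j dν − ∫x^j dμ| ≤ r` and a `1`-Lipschitz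
`g : ℝ → [0,1]` with `|∫g dν − ∫g dμ| ≥ (1∕6)∕(1 + log r⁻¹)` (§2 at `r = 2·2^{−n} ≤ r₀`: gap `1∕(πn)`, `log r⁻¹ = (n−1)log 2`, `π ≤ 4`, `log 2 > 0.69`).
So NO `log log` loss in this currency (contrast p555512's `log(e+L)∕(1+L)` for the window-cgf currency), and nothing better than `1∕log r⁻¹`. -/
theorem uniformMoment_price_two_sided :
    (∀ (μ ν : Measure ℝ) [IsProbabilityMeasure μ] [IsProbabilityMeasure ν],
      μ (Set.Icc (-1 : ℝ) 1)ᶜ = 0 → ν (Set.Icc (-1 : ℝ) 1)ᶜ = 0 → ∀ r : ℝ, 0 < r → r ≤ 1 →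
      (∀ j : ℕ, |∫ x, x ^ j ∂ν - ∫ x, x ^ j ∂μ| ≤ r) →
      ∀ g : ℝ → ℝ, Continuous g → ∀ K G : ℝ, 0 ≤ K →
        (∀ x y : ℝ, x ∈ Set.Icc (-1 : ℝ) 1 → y ∈ Set.Icc (-1 : ℝ) 1 → |g x - g y| ≤ K * |x - y|) →
        (∀ x : ℝ, x ∈ Set.Icc (-1 : ℝ) 1 → |g x| ≤ G) →
          |∫ x, g x ∂ν - ∫ x, g x ∂μ| ≤ 48 * (K + G) / (1 + Real.log r⁻¹)) ∧
    (∀ r₀ : ℝ, 0 < r₀ → r₀ ≤ 1 → ∃ μ ν : Measure ℝ, IsProbabilityMeasure μ ∧ IsProbabilityMeasure ν ∧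
      μ (Set.Icc (0 : ℝ) 1)ᶜ = 0 ∧ ν (Set.Icc (0 : ℝ) 1)ᶜ = 0 ∧
      ∃ r : ℝ, 0 < r ∧ r ≤ r₀ ∧ (∀ j : ℕ, |∫ x, x ^ j ∂ν - ∫ x, x ^ j ∂μ| ≤ r) ∧
        ∃ g : ℝ → ℝ, LipschitzWith 1 g ∧ (∀ x, 0 ≤ g x ∧ g x ≤ 1) ∧
          1 / 6 / (1 + Real.log r⁻¹) ≤ |∫ x, g x ∂ν - ∫ x, g x ∂μ|) := by
  refine ⟨fun μ ν _ _ hμ hν r hr0 hr1 hmom g hg K G hK0 hK hG => law_price_le_of_uniformMoments hμ hν hr0 hr1 hmom hg hK0 hK hG,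
    fun r₀ hr₀ hr₀1 => ?_⟩
  -- choose `n ≥ 1` with `2·2^{−n} ≤ r₀`
  obtain ⟨n₀, hn₀⟩ := exists_pow_lt_of_lt_one (half_pos hr₀) (by norm_num : (1 / 2 : ℝ) < 1)
  set n : ℕ := n₀ + 1 with hndef
  have hn : 0 < n := Nat.succ_pos _
  have hnr : (0 : ℝ) < n := Nat.cast_pos.2 hn
  have hrn : 2 * (1 / 2 : ℝ) ^ n ≤ r₀ := by
    have : (1 / 2 : ℝ) ^ n ≤ (1 / 2) ^ n₀ := pow_le_pow_of_le_one (by norm_num) (by norm_num) (Nat.le_succ _)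
    linarith
  obtain ⟨μ, ν, iμ, iν, hμ, hν, hmom, -, htest⟩ := exists_uniformMoments_close_laws_far hn
  refine ⟨μ, ν, iμ, iν, hμ, hν, 2 * (1 / 2 : ℝ) ^ n, by positivity, hrn, hmom,
    fun x => (1 - cos (π * (2 * n : ℕ) * x)) / (π * (2 * n : ℕ)), lipschitzWith_one_cosWave (by omega), fun x => ⟨cosWave_nonneg _ _, ?_⟩, ?_⟩
  · -- values `≤ 2∕(π·2n) ≤ 1`
    refine (cosWave_le _ _).trans ?_
    have h2n : (1 : ℝ) ≤ (2 * n : ℕ) := by exact_mod_cast (by omega : 1 ≤ 2 * n)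
    rw [div_le_one (by positivity)]
    nlinarith [Real.pi_gt_three]
  · -- `(1∕6)∕(1 + log r⁻¹) ≤ 1∕(πn)` with `log r⁻¹ = (n − 1)·log 2`
    rw [htest]
    have hL : Real.log (2 * (1 / 2 : ℝ) ^ n)⁻¹ = (n - 1) * Real.log 2 := by
      rw [Real.log_inv, hndef, pow_succ]
      rw [show (2 : ℝ) * ((1 / 2) ^ n₀ * (1 / 2)) = (1 / 2) ^ n₀ by ring, Real.log_pow]
      push_cast
      rw [one_div, Real.log_inv]
      ring
    rw [hL, div_le_div_iff₀ (by nlinarith [Real.log_pos one_lt_two, hnr, show (1 : ℝ) ≤ n from by exact_mod_cast hn]) (by positivity)]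
    have hl2 := Real.log_two_gt_d9
    have hπ := Real.pi_le_four
    have hn1 : (1 : ℝ) ≤ n := by exact_mod_cast hn
    nlinarith [Real.pi_pos]

end Summit.QuantumFields.YangMills.Theorems.BalabanUVNodesN19UniformMomentPriceTwoSided

end
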